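import Summits.CriticalPhenomena.PercolationContinuityZ3.Theorems.PercNearOneGluingAdditiveGluingQ9Line
import Summits.CriticalPhenomena.PercolationContinuityZ3.Theorems.PercNearOneGluingNoHeavyLowerTailTypedReductions
import Summits.CriticalPhenomena.PercolationContinuityZ3.Theses.PercNearOneGluingNoHeavy
import HarnessLib

/-!
# `NoHeavyLowerTail` (stmt-CriticalPhenomena-4575) / `AdditiveGluing` (stmt-CriticalPhenomena-4576):
# both follow from the SET FORM OF KOZMA–NITZAN QUESTION 9 (route task `nh-dp-commonrelay`, gen 1)

Support file (`--supports stmt-CriticalPhenomena-4575`).  No definitions, no named facts.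

The clean statement behind the Q9 line (this seat, item evidence MERGE-LAW.md §10): for a weighted graph `u` on
`Fin n`, a relay set `A ∋ b`, a minimiser `a₀ ∈ A` of `a ↦ μ(a ↔ b)` over `A`, ANY vertex set `S` disjoint from `A`
and any selection `sel` of relays for the dead clusters of `S`, Kozma–Nitzan block goodness holds:
`μ(a₀↔b) + μ(a₀↮b, a₀↔S, S↔b) ≤ μ(S↔b) + Σ_{W ∩ A = ∅} μ(K_S = W)·μ_{off W}(sel W ↔ b)`, i.e.
`μ_{u/S}(a₀ ↔ b) ≤ Φ_u(S)` ("set form of Question 9", `SetQ9` below, stated inline as a hypothesis).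
* Kozma–Nitzan's Question 9 (arXiv:2401.12397, p. 36, with the selection pockets of §3.2) is the special case in which
  `S` is a set of pendant leaves (split the observer `0` into one leaf per edge: then `u/S = G`, `argmin_u = argmin_{G−0}`);
* the Q9-line kernel `hres9` of `additiveGluing_of_residualKernelQ9` is the special case of a bad block (`2 ≤ |S|`,
  `4 ≤ |A|`, drift, `IH9` — all simply dropped): `residualKernelQ9_of_setQ9`;
* hence `SetQ9 ⇒ AdditiveGluing` (4576) and `SetQ9 ⇒ NoHeavyLowerTail` (4575).
Status: conjecture (numerics: 0 violations in 3 700 annealed exact instances, n ≤ 8, |S| ≤ 4; minimality of `a₀` is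
essential — false for a non-minimal designated relay at a 3·10⁻³ near-tie).  It implies KN Question 9 and is implied by
nothing in print. [cite: KozmaNitzan2024, §3.2 (Definition p. 12, Thms 4–5 pp. 12–14), Question 9 (p. 36)]
-/

namespace Summit.CriticalPhenomena.PercolationContinuityZ3.Theorems

open MeasureTheory Set
open Literature.Probability.LatticeModels (prodBernoulli)
open Literature.Probability.Percolation (BondConfig openConn openConnIn openGraph openCluster)
open scoped BigOperators

noncomputable section
open Classical

section SetQ9
open Literature.Probability.LatticeModels Literature.Probability.Percolation

variable {n : ℕ}

/-- **Set form of Question 9 ⇒ the Q9-line kernel `hres9`** (drop the hypotheses `2 ≤ |S|`, `4 ≤ |A|`, badness,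
drift and `IH9`). [cite: KozmaNitzan2024, Question 9 (p. 36)] -/
theorem residualKernelQ9_of_setQ9
    (hCK : (∀ (n : ℕ) (u : Sym2 (Fin n) → unitInterval) (A S : Finset (Fin n)) (b a₀ : Fin n)
      (sel : Finset (Fin n) → Fin n),
      b ∈ A → Disjoint S A → (∀ W, sel W ∈ A) → a₀ ∈ A →
      (∀ a ∈ A, (prodBernoulli u).real (openConn a₀ b) ≤ (prodBernoulli u).real (openConn a b)) →
      ((prodBernoulli u).real (openConn a₀ b)
          + (prodBernoulli u).real ((openConn a₀ b)ᶜ ∩ (⋃ s ∈ S, openConn a₀ s) ∩ (⋃ s ∈ S, openConn s b))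
        ≤ (prodBernoulli u).real (⋃ s ∈ S, openConn s b)
          + ∑ W ∈ (Finset.univ : Finset (Finset (Fin n))).filter (fun W => Disjoint W A),
              (prodBernoulli u).real {ω : BondConfig (Fin n) | ∀ z : Fin n, (z ∈ W ↔ ω ∈ ⋃ s ∈ S, openConn s z)}
                * (prodBernoulli u).real (openConnIn ((W : Set (Fin n))ᶜ) (sel W) b)))) :
    (∀ (n : ℕ) (u : Sym2 (Fin n) → unitInterval) (A S : Finset (Fin n)) (b a₀ : Fin n)
      (sel : Finset (Fin n) → Fin n),
      b ∈ A → Disjoint S A → 2 ≤ S.card → 4 ≤ A.card → (∀ W, sel W ∈ A) → a₀ ∈ A →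
      (∀ a ∈ A, (prodBernoulli u).real (openConn a₀ b) ≤ (prodBernoulli u).real (openConn a b)) →
      (∀ v ∈ S, (prodBernoulli u).real (openConn v b) < (prodBernoulli u).real (openConn a₀ b)) →
      (∃ a ∈ A, (prodBernoulli (fun e : Sym2 (Fin n) => if (∀ x ∈ e, x ∈ S) ∧ ¬ e.IsDiag then 1 else u e)).real (openConn a b) <
        (prodBernoulli (fun e : Sym2 (Fin n) => if (∀ x ∈ e, x ∈ S) ∧ ¬ e.IsDiag then 1 else u e)).real (openConn a₀ b)) →
      (∀ w' : Sym2 (Fin n) → unitInterval,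
        (Finset.univ.filter (fun v : Fin n => ∃ z : Fin n, 0 < (w' s(z, v) : ℝ))).card ≤
          (Finset.univ.filter (fun v : Fin n => ∃ z : Fin n,
            0 < ((fun e : Sym2 (Fin n) => if (∀ x ∈ e, x ∈ S) ∧ ¬ e.IsDiag then 1 else u e) s(z, v) : ℝ))).card →
        ∀ (A' : Finset (Fin n)) (o' b' : Fin n), b' ∈ A' → o' ∉ A' →
        ∀ c₀ : Fin n, c₀ ∈ A' →
          (∀ c ∈ A', (prodBernoulli (fun e : Sym2 (Fin n) => if o' ∈ e then (0 : unitInterval) else w' e)).real (openConn c₀ b') ≤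
            (prodBernoulli (fun e : Sym2 (Fin n) => if o' ∈ e then (0 : unitInterval) else w' e)).real (openConn c b')) →
          ∀ sel' : Finset (Fin n) → Fin n, (∀ W', sel' W' ∈ A') →
          (prodBernoulli w').real (openConn c₀ b') ≤
            (prodBernoulli w').real (openConn o' b')
              + ∑ W' ∈ (Finset.univ : Finset (Finset (Fin n))).filter (fun W' => o' ∈ W' ∧ Disjoint W' A'),
                  (prodBernoulli w').real {ω : BondConfig (Fin n) | openCluster ω o' = (W' : Set (Fin n))}
                    * (prodBernoulli w').real (openConnIn ((W' : Set (Fin n))ᶜ) (sel' W') b')) →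
      ((prodBernoulli u).real (openConn a₀ b)
          + (prodBernoulli u).real ((openConn a₀ b)ᶜ ∩ (⋃ s ∈ S, openConn a₀ s) ∩ (⋃ s ∈ S, openConn s b))
        ≤ (prodBernoulli u).real (⋃ s ∈ S, openConn s b)
          + ∑ W ∈ (Finset.univ : Finset (Finset (Fin n))).filter (fun W => Disjoint W A),
              (prodBernoulli u).real {ω : BondConfig (Fin n) | ∀ z : Fin n, (z ∈ W ↔ ω ∈ ⋃ s ∈ S, openConn s z)}
                * (prodBernoulli u).real (openConnIn ((W : Set (Fin n))ᶜ) (sel W) b))) := by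
  intro n u A S b a₀ sel hb hSA _h2 _hA4 hsel ha₀ hmin _hbad _hdrift _IH9
  exact hCK n u A S b a₀ sel hb hSA hsel ha₀ hmin

/-- **Set form of Question 9 ⇒ `AdditiveGluing`** (crux stmt-CriticalPhenomena-4576). [cite: KozmaNitzan2024, Conjecture 1 (p. 3), Question 9 (p. 36)] -/
theorem additiveGluing_of_setQ9 :
    (∀ (n : ℕ) (u : Sym2 (Fin n) → unitInterval) (A S : Finset (Fin n)) (b a₀ : Fin n)
      (sel : Finset (Fin n) → Fin n),
      b ∈ A → Disjoint S A → (∀ W, sel W ∈ A) → a₀ ∈ A →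
      (∀ a ∈ A, (prodBernoulli u).real (openConn a₀ b) ≤ (prodBernoulli u).real (openConn a b)) →
      ((prodBernoulli u).real (openConn a₀ b)
          + (prodBernoulli u).real ((openConn a₀ b)ᶜ ∩ (⋃ s ∈ S, openConn a₀ s) ∩ (⋃ s ∈ S, openConn s b))
        ≤ (prodBernoulli u).real (⋃ s ∈ S, openConn s b)
          + ∑ W ∈ (Finset.univ : Finset (Finset (Fin n))).filter (fun W => Disjoint W A),
              (prodBernoulli u).real {ω : BondConfig (Fin n) | ∀ z : Fin n, (z ∈ W ↔ ω ∈ ⋃ s ∈ S, openConn s z)}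
                * (prodBernoulli u).real (openConnIn ((W : Set (Fin n))ᶜ) (sel W) b))) →
    Summit.CriticalPhenomena.PercolationContinuityZ3.Theses.PercNearOneGluing.AdditiveGluing := fun hCK =>
  additiveGluing_of_residualKernelQ9 (residualKernelQ9_of_setQ9 hCK)

/-- **Set form of Question 9 ⇒ `NoHeavyLowerTail`** (crux stmt-CriticalPhenomena-4575). [cite: KozmaNitzan2024, Conjecture 3 (p. 15)] -/
theorem noHeavyLowerTail_of_setQ9 :
    (∀ (n : ℕ) (u : Sym2 (Fin n) → unitInterval) (A S : Finset (Fin n)) (b a₀ : Fin n)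
      (sel : Finset (Fin n) → Fin n),
      b ∈ A → Disjoint S A → (∀ W, sel W ∈ A) → a₀ ∈ A →
      (∀ a ∈ A, (prodBernoulli u).real (openConn a₀ b) ≤ (prodBernoulli u).real (openConn a b)) →
      ((prodBernoulli u).real (openConn a₀ b)
          + (prodBernoulli u).real ((openConn a₀ b)ᶜ ∩ (⋃ s ∈ S, openConn a₀ s) ∩ (⋃ s ∈ S, openConn s b))
        ≤ (prodBernoulli u).real (⋃ s ∈ S, openConn s b)
          + ∑ W ∈ (Finset.univ : Finset (Finset (Fin n))).filter (fun W => Disjoint W A),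
              (prodBernoulli u).real {ω : BondConfig (Fin n) | ∀ z : Fin n, (z ∈ W ↔ ω ∈ ⋃ s ∈ S, openConn s z)}
                * (prodBernoulli u).real (openConnIn ((W : Set (Fin n))ᶜ) (sel W) b))) →
    Summit.CriticalPhenomena.PercolationContinuityZ3.Theses.PercNearOneGluing.NoHeavyLowerTail := fun hCK =>
  noHeavyLowerTail_of_manyFingersLargePocket
    (manyFingersLargePocket_of_nearOneGluing (additiveGluingSuffices_proof (additiveGluing_of_setQ9 hCK)))

/-- Same, typed against the sibling route `PercNearOneGluingNoHeavy`. -/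
theorem noHeavyLowerTail_noHeavy_of_setQ9 :
    (∀ (n : ℕ) (u : Sym2 (Fin n) → unitInterval) (A S : Finset (Fin n)) (b a₀ : Fin n)
      (sel : Finset (Fin n) → Fin n),
      b ∈ A → Disjoint S A → (∀ W, sel W ∈ A) → a₀ ∈ A →
      (∀ a ∈ A, (prodBernoulli u).real (openConn a₀ b) ≤ (prodBernoulli u).real (openConn a b)) →
      ((prodBernoulli u).real (openConn a₀ b)
          + (prodBernoulli u).real ((openConn a₀ b)ᶜ ∩ (⋃ s ∈ S, openConn a₀ s) ∩ (⋃ s ∈ S, openConn s b))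
        ≤ (prodBernoulli u).real (⋃ s ∈ S, openConn s b)
          + ∑ W ∈ (Finset.univ : Finset (Finset (Fin n))).filter (fun W => Disjoint W A),
              (prodBernoulli u).real {ω : BondConfig (Fin n) | ∀ z : Fin n, (z ∈ W ↔ ω ∈ ⋃ s ∈ S, openConn s z)}
                * (prodBernoulli u).real (openConnIn ((W : Set (Fin n))ᶜ) (sel W) b))) →
    Summit.CriticalPhenomena.PercolationContinuityZ3.Theses.PercNearOneGluingNoHeavy.NoHeavyLowerTail := fun hCK =>
  noHeavyLowerTail_of_setQ9 hCK

end SetQ9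

end

end Summit.CriticalPhenomena.PercolationContinuityZ3.Theorems
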